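/-
Copyright (c) 2026 the pub-hodgecm-mathlib formalisation cell (harness21).  Prover seat hodgecm-mathlib-K2E3-p23 (g6), HCML Track B «K2-LIT» ∕ h413
(`stmt-HodgeConjecture-24833`), line `K2_E3_EllipticInputs`, leaf (nsc-S-A′) `sig_K2E3GL3PrincipalBlockStandardSpan`, H-layer tool brick EXH of the architect's
`MEMO-SA-architecture.v2.K2E3-p25-g2.md` §1 (architect K2E3-p25 (g2); dealer K2E3-plan (g4) D87).  2026-09-04.
-/
import Summits.HodgeConjecture.HodgeConjecture.Theorems.K2E3GL3JacquetMultiplicityAdditive                -- ★ ADD (K2E3-p17 g8): additivity ∕ monotonicity ∕ `Equiv`-invariance of `mult`, `r_B` f.d. along subs and quotients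
import Summits.HodgeConjecture.HodgeConjecture.Theorems.K2E3GL3PrincipalSeriesExponents                   -- ★ H0-a (K2E3-p25 g0): `r_B (I θ)` finite-dimensional (and its exponents)
import Summits.HodgeConjecture.HodgeConjecture.Theorems.K2E3GL3PrincipalSeriesConstituentsJacquetNonzero   -- ★ E4a (K2E3-p17 g7): constituents of `I θ` have `r_B ≠ 0` (modulo `h3cell`)
import Literature.NumberTheory.Automorphic.IrreducibleClassesConstituents                                  -- ★ `IrrClass.exists_isConstituentOf`, `IsConstituentOf.of_quotientRep ∕ of_subrepresentation`
import HarnessLib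

/-!
# Crux `H413` — leaf (nsc-S-A′), H-layer tool EXH: EXHAUSTION — a subrepresentation of the principal series `I θ` with the exponents of `I θ` is everything

Cell `hodgecm-mathlib`, Track B; THEOREMS ONLY; count-neutral helper (`--supports stmt-HodgeConjecture-24833 --as helper`).  Currency (CONVENTIONS 08:40Z, MEMO v2 §0):
`LB 3 = Π a : Fin 3, GL {i // id i = a} F`, `tch θ = ∏ a, (θ a) ∘ det ∘ ev_a`, `I θ = parabolicIndGL F id (𝟙.twist (tch θ))`, `r_B V = (restrictUnipotentGL F id V).Coinvariants`,
`mult V η = finrank ℂ ↥(⨅ m, maxGenEigenspace (normalizedJacquetGL F id V m) (η m))` (written inline; no definition).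

THE MATHEMATICS ([BernsteinZelevinsky1977, §2.3, Cor. 2.13, Thm. 2.9]; [Casselman1995, §6.3]).  Every constituent of `I θ` has a non-zero Borel Jacquet module (★ E4a,
modulo the weak 3-cell lemma `h3cell`); the Jacquet functor is exact (★ ADD §1) and `r_B (I θ)` is finite-dimensional (★ H0-a) with a COMMUTING torus action, so:
* §1 (any smooth `V` of `GL_n(F)` with `r_B V` finite-dimensional all of whose constituents have `r_B ≠ 0`):
  **`exists_finrank_weightSpace_ne_zero_of_constituents`** — a non-zero such `V` HAS A WEIGHT (`∃ η, mult V η ≠ 0`): a constituent `r ≅ N₁ ⁄ N₂` exists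
  (★ `IrrClass.exists_isConstituentOf`), `r_B r ≠ 0` is finite-dimensional with commuting torus hence has a weight (★ E1a), and `mult r ≤ mult N₁ ≤ mult V` (★ ADD);
  **`eq_top_of_forall_finrank_weightSpace_eq`** — `mult N = mult V` for all `η` forces `N = ⊤` (else `V ⁄ N` has a weight and ★ ADD additivity is violated);
  **`eq_of_le_of_forall_finrank_weightSpace_eq`** — «equal exponents ⇒ equal» for `N₁ ≤ N₂ ≤ V`; **`exists_finrank_weightSpace_quotientRep_ne_zero`** ∕
  **`…_subquotient_…`** — every non-zero quotient ∕ subquotient has a weight.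
* §2 the principal series `I θ` (`θ : Fin 3 → (Fˣ →* ℂˣ)` with `ker (tch θ)` open; `h3cell` = ★ E4a's hypothesis VERBATIM, discharged later by E4b): the four statements
  above for `V = I θ`: **`exists_finrank_weightSpace_quotientRep_principalSeries_ne_zero`** (EXH (a)), **`eq_top_of_forall_finrank_weightSpace_eq_principalSeries`**
  (EXH (b)), **`eq_of_le_of_forall_finrank_weightSpace_eq_principalSeries`**, **`exists_finrank_weightSpace_subquotient_principalSeries_ne_zero`** (EXH (c))
  (constituent feed = ★ E4a `nontrivial_coinvariants_of_isConstituentOf_principalSeries_three_tuple` BY NAME).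

HONEST LABEL: HC_CM is proved only modulo the 7 printed citations (2 remaining named inputs: hLiu418 = stmt-HodgeConjecture-24832, h413 = stmt-HodgeConjecture-24833) until
rung 0 closes; count-neutral helper, closes no socket; §2 is CONDITIONAL on the binder `h3cell` (E4b), stated not assumed as a fact.

## References
* [BernsteinZelevinsky1977] I. N. Bernstein, A. V. Zelevinsky, *Induced representations of reductive p-adic groups I*, Ann. Sci. ÉNS 10 (1977), Prop. 1.9 (a), §2.3, Cor. 2.13, Thm. 2.9.
* [Casselman1995] W. Casselman, *Introduction to the theory of admissible representations of p-adic reductive groups* (draft 1995), §6.3 (Thm. 6.3.5, 6.3.7).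
* [Zelevinsky1980] A. V. Zelevinsky, *Induced representations of reductive p-adic groups II*, Ann. Sci. ÉNS 13 (1980), §1.
-/

set_option autoImplicit false
-- the mandated namespace repeats `HodgeConjecture.HodgeConjecture`, as in every `Theorems/*.lean` of this sub-problem
set_option linter.dupNamespace false

noncomputable section

open Representation Module Function Literature.NumberTheory.Automorphic Literature.NumberTheory.GaloisRepresentations.IsNonarchimedeanLocalField
open scoped MatrixGroups
open Summit.HodgeConjecture.HodgeConjecture.Cruxes.H413.K2E3JacquetExponentMultiset (subsingleton_of_forall_weightSpace_eq_bot)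
open Summit.HodgeConjecture.HodgeConjecture.Cruxes.H413.K2E3GL3JacquetMultiplicityAdditive
open Summit.HodgeConjecture.HodgeConjecture.Cruxes.H413.K2E3GL3PrincipalSeriesExponents (finrank_weightSpace_principalSeries_three_tch)
open Summit.HodgeConjecture.HodgeConjecture.Cruxes.H413.K2E3GL3PrincipalSeriesConstituentsJacquetNonzero (nontrivial_coinvariants_of_isConstituentOf_principalSeries_three_tuple)

namespace Summit.HodgeConjecture.HodgeConjecture.Cruxes.H413.K2E3GL3PrincipalSeriesExhaustion

/-! ## §1 Smooth representations of `GL_n(F)` with finite-dimensional `r_B` all of whose constituents have `r_B ≠ 0` -/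

section General

variable {F : Type} [Field F] [ValuativeRel F] [TopologicalSpace F] [IsNonarchimedeanLocalField F] {n : ℕ}
  {X : Type} [AddCommGroup X] [Module ℂ X] (V : Representation ℂ (GL (Fin n) F) X)

/-- **A NON-ZERO SMOOTH `V` WITH `r_B V` FINITE-DIMENSIONAL, ALL OF WHOSE CONSTITUENTS HAVE `r_B ≠ 0`, HAS A WEIGHT**: `∃ η, mult V η ≠ 0`.  A constituent
`r ≅ N₁ ⁄ N₂` exists (★ `IrrClass.exists_isConstituentOf`); `r_B r ≅ r_B (N₁ ⁄ N₂) ≠ 0` is finite-dimensional with commuting torus action, so some weight space is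
non-zero (★ E1a); and `mult (N₁ ⁄ N₂) ≤ mult N₁ ≤ mult V` (★ ADD). [cite: BernsteinZelevinsky1977, Prop. 1.9 (a), Cor. 2.13] [cite: Casselman1995, §6.3] -/
theorem exists_finrank_weightSpace_ne_zero_of_constituents [Nontrivial X] (hV : V.IsSmooth)
    [FiniteDimensional ℂ (restrictUnipotentGL F (id : Fin n → Fin n) V).Coinvariants]
    (hJ : ∀ r : SmoothIrrep (GL (Fin n) F), (IrrClass.mk r).IsConstituentOf V →
      Nontrivial (restrictUnipotentGL F (id : Fin n → Fin n) r.ρ).Coinvariants) :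
    ∃ η : (Π a : Fin n, GL {i : Fin n // (id : Fin n → Fin n) i = a} F) → ℂ,
      finrank ℂ ↥(⨅ m, Module.End.maxGenEigenspace (normalizedJacquetGL F (id : Fin n → Fin n) V m) (η m)) ≠ 0 := by
  obtain ⟨c, hc⟩ := IrrClass.exists_isConstituentOf V hV
  obtain ⟨r, -, N₁, N₂, hle, ⟨e⟩⟩ := hc
  have hr : (IrrClass.mk r).IsConstituentOf V := ⟨r, rfl, N₁, N₂, hle, ⟨e⟩⟩
  haveI := hJ r hr
  -- the subquotient `N₁ ⁄ (N₂ ⊓ N₁)` as the quotient of `N₁` by the pulled-back subrepresentation `N₂'`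
  let N₂' : Subrepresentation N₁.toRepresentation :=
    ⟨N₂.toSubmodule.comap N₁.toSubmodule.subtype, fun g _ hx => N₂.apply_mem_toSubmodule g hx⟩
  have e' : r.ρ.Equiv N₂'.quotientRep := e
  have hN₁s : N₁.toRepresentation.IsSmooth := hV.toRepresentation N₁
  haveI : FiniteDimensional ℂ (restrictUnipotentGL F (id : Fin n → Fin n) N₁.toRepresentation).Coinvariants :=
    finiteDimensional_jacquet_subrepresentation V monotone_id hV N₁
  haveI : FiniteDimensional ℂ (restrictUnipotentGL F (id : Fin n → Fin n) N₂'.quotientRep).Coinvariants :=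
    finiteDimensional_jacquet_quotientRep N₁.toRepresentation N₂'
  obtain ⟨E, -, -⟩ := exists_linearEquiv_jacquet_of_equiv (c := (id : Fin n → Fin n)) e'
  haveI : Nontrivial (restrictUnipotentGL F (id : Fin n → Fin n) N₂'.quotientRep).Coinvariants := E.symm.toEquiv.nontrivial
  -- a non-zero finite-dimensional space with commuting torus action has a non-zero weight space
  obtain ⟨η, hη⟩ : ∃ η : (Π a : Fin n, GL {i : Fin n // (id : Fin n → Fin n) i = a} F) → ℂ,
      (⨅ m, Module.End.maxGenEigenspace (normalizedJacquetGL F (id : Fin n → Fin n) N₂'.quotientRep m) (η m)) ≠ ⊥ := by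
    by_contra hall
    push Not at hall
    exact not_subsingleton _
      (subsingleton_of_forall_weightSpace_eq_bot _ (commute_normalizedJacquetGL_id N₂'.quotientRep) hall)
  refine ⟨η, fun h0 => ?_⟩
  have h1 : finrank ℂ ↥(⨅ m, Module.End.maxGenEigenspace (normalizedJacquetGL F (id : Fin n → Fin n) N₂'.quotientRep m) (η m)) ≠ 0 :=
    fun h => hη (Submodule.finrank_eq_zero.1 h)
  have h2 := finrank_weightSpace_quotientRep_le N₁.toRepresentation hN₁s N₂' η
  have h3 := finrank_weightSpace_subrepresentation_le V hV N₁ η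
  omega

/-- **EXHAUSTION**: for `V` smooth with `r_B V` finite-dimensional all of whose constituents have `r_B ≠ 0`, a subrepresentation `N` with `mult N η = mult V η` for every
`η` is ALL of `V` — otherwise `V ⁄ N ≠ 0` has a weight (previous theorem, constituents of `V ⁄ N` being constituents of `V`) and ★ ADD additivity
`mult V = mult N + mult (V ⁄ N)` is violated. [cite: BernsteinZelevinsky1977, Cor. 2.13] [cite: Casselman1995, §6.3] -/
theorem eq_top_of_forall_finrank_weightSpace_eq (hV : V.IsSmooth) [FiniteDimensional ℂ (restrictUnipotentGL F (id : Fin n → Fin n) V).Coinvariants]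
    (hJ : ∀ r : SmoothIrrep (GL (Fin n) F), (IrrClass.mk r).IsConstituentOf V →
      Nontrivial (restrictUnipotentGL F (id : Fin n → Fin n) r.ρ).Coinvariants)
    (N : Subrepresentation V)
    (h : ∀ η : (Π a : Fin n, GL {i : Fin n // (id : Fin n → Fin n) i = a} F) → ℂ,
      finrank ℂ ↥(⨅ m, Module.End.maxGenEigenspace (normalizedJacquetGL F (id : Fin n → Fin n) N.toRepresentation m) (η m)) =
        finrank ℂ ↥(⨅ m, Module.End.maxGenEigenspace (normalizedJacquetGL F (id : Fin n → Fin n) V m) (η m))) :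
    N = ⊤ := by
  by_contra hN
  have hNt : N.toSubmodule ≠ ⊤ := fun h' => hN (Subrepresentation.toSubmodule_injective h')
  haveI : Nontrivial (X ⧸ N.toSubmodule) := Submodule.Quotient.nontrivial_iff.2 hNt
  haveI : FiniteDimensional ℂ (restrictUnipotentGL F (id : Fin n → Fin n) N.quotientRep).Coinvariants :=
    finiteDimensional_jacquet_quotientRep V N
  obtain ⟨η, hη⟩ := exists_finrank_weightSpace_ne_zero_of_constituents N.quotientRep (hV.quotientRep N)
    (fun r hr => hJ r (hr.of_quotientRep N))
  have hadd := finrank_weightSpace_eq_add_subrepresentation V hV N η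
  rw [h η] at hadd
  omega

/-- **«EQUAL EXPONENTS ⇒ EQUAL» for nested subrepresentations `N₁ ≤ N₂ ≤ V`** (`V` as above): `mult N₁ η = mult N₂ η` for every `η` forces `N₁ = N₂` — the previous
theorem inside `N₂` (whose constituents are constituents of `V`), reading `N₁` as a subrepresentation of `N₂` (`Submodule.comapSubtypeEquivOfLe`, ★ ADD `Equiv`-invariance).
[cite: BernsteinZelevinsky1977, Cor. 2.13] -/
theorem eq_of_le_of_forall_finrank_weightSpace_eq (hV : V.IsSmooth) [FiniteDimensional ℂ (restrictUnipotentGL F (id : Fin n → Fin n) V).Coinvariants]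
    (hJ : ∀ r : SmoothIrrep (GL (Fin n) F), (IrrClass.mk r).IsConstituentOf V →
      Nontrivial (restrictUnipotentGL F (id : Fin n → Fin n) r.ρ).Coinvariants)
    {N₁ N₂ : Subrepresentation V} (hle : N₁ ≤ N₂)
    (h : ∀ η : (Π a : Fin n, GL {i : Fin n // (id : Fin n → Fin n) i = a} F) → ℂ,
      finrank ℂ ↥(⨅ m, Module.End.maxGenEigenspace (normalizedJacquetGL F (id : Fin n → Fin n) N₁.toRepresentation m) (η m)) =
        finrank ℂ ↥(⨅ m, Module.End.maxGenEigenspace (normalizedJacquetGL F (id : Fin n → Fin n) N₂.toRepresentation m) (η m))) :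
    N₁ = N₂ := by
  have hN₂s : N₂.toRepresentation.IsSmooth := hV.toRepresentation N₂
  haveI : FiniteDimensional ℂ (restrictUnipotentGL F (id : Fin n → Fin n) N₂.toRepresentation).Coinvariants :=
    finiteDimensional_jacquet_subrepresentation V monotone_id hV N₂
  let N₁' : Subrepresentation N₂.toRepresentation :=
    ⟨N₁.toSubmodule.comap N₂.toSubmodule.subtype, fun g _ hx => N₁.apply_mem_toSubmodule g hx⟩
  have e : N₁'.toRepresentation.Equiv N₁.toRepresentation :=
    Representation.Equiv.mk (Submodule.comapSubtypeEquivOfLe hle) fun g => LinearMap.ext fun _ => rfl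
  have htop : N₁' = ⊤ :=
    eq_top_of_forall_finrank_weightSpace_eq N₂.toRepresentation hN₂s (fun r hr => hJ r (hr.of_subrepresentation N₂)) N₁'
      fun η => by rw [finrank_weightSpace_eq_of_equiv _ _ e η, h η]
  refine le_antisymm hle fun v hv => ?_
  have hv' : (⟨v, hv⟩ : ↥N₂.toSubmodule) ∈ N₁' := by rw [htop]; trivial
  exact hv'

/-- **Every NON-ZERO QUOTIENT `V ⁄ N` has a weight** (`V` as above, `N ≠ ⊤`). [cite: BernsteinZelevinsky1977, Cor. 2.13, Thm. 2.9] -/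
theorem exists_finrank_weightSpace_quotientRep_ne_zero (hV : V.IsSmooth) [FiniteDimensional ℂ (restrictUnipotentGL F (id : Fin n → Fin n) V).Coinvariants]
    (hJ : ∀ r : SmoothIrrep (GL (Fin n) F), (IrrClass.mk r).IsConstituentOf V →
      Nontrivial (restrictUnipotentGL F (id : Fin n → Fin n) r.ρ).Coinvariants)
    (N : Subrepresentation V) (hN : N ≠ ⊤) :
    ∃ η : (Π a : Fin n, GL {i : Fin n // (id : Fin n → Fin n) i = a} F) → ℂ,
      finrank ℂ ↥(⨅ m, Module.End.maxGenEigenspace (normalizedJacquetGL F (id : Fin n → Fin n) N.quotientRep m) (η m)) ≠ 0 := by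
  have hNt : N.toSubmodule ≠ ⊤ := fun h' => hN (Subrepresentation.toSubmodule_injective h')
  haveI : Nontrivial (X ⧸ N.toSubmodule) := Submodule.Quotient.nontrivial_iff.2 hNt
  haveI : FiniteDimensional ℂ (restrictUnipotentGL F (id : Fin n → Fin n) N.quotientRep).Coinvariants :=
    finiteDimensional_jacquet_quotientRep V N
  exact exists_finrank_weightSpace_ne_zero_of_constituents N.quotientRep (hV.quotientRep N) fun r hr => hJ r (hr.of_quotientRep N)

/-- **Every NON-ZERO SUBQUOTIENT `N₁ ⁄ N₂'` has a weight** (`V` as above; `N₁ ≤ V`, `N₂' < N₁` a proper subrepresentation of `N₁`).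
[cite: BernsteinZelevinsky1977, Cor. 2.13, Thm. 2.9] -/
theorem exists_finrank_weightSpace_subquotient_ne_zero (hV : V.IsSmooth) [FiniteDimensional ℂ (restrictUnipotentGL F (id : Fin n → Fin n) V).Coinvariants]
    (hJ : ∀ r : SmoothIrrep (GL (Fin n) F), (IrrClass.mk r).IsConstituentOf V →
      Nontrivial (restrictUnipotentGL F (id : Fin n → Fin n) r.ρ).Coinvariants)
    (N₁ : Subrepresentation V) (N₂' : Subrepresentation N₁.toRepresentation) (hN : N₂' ≠ ⊤) :
    ∃ η : (Π a : Fin n, GL {i : Fin n // (id : Fin n → Fin n) i = a} F) → ℂ,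
      finrank ℂ ↥(⨅ m, Module.End.maxGenEigenspace (normalizedJacquetGL F (id : Fin n → Fin n) N₂'.quotientRep m) (η m)) ≠ 0 := by
  haveI : FiniteDimensional ℂ (restrictUnipotentGL F (id : Fin n → Fin n) N₁.toRepresentation).Coinvariants :=
    finiteDimensional_jacquet_subrepresentation V monotone_id hV N₁
  exact exists_finrank_weightSpace_quotientRep_ne_zero N₁.toRepresentation (hV.toRepresentation N₁)
    (fun r hr => hJ r (hr.of_subrepresentation N₁)) N₂' hN

end General

/-! ## §2 The principal series `I θ` of `GL₃(F)` -/

section PrincipalSeries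

variable {F : Type} [Field F] [ValuativeRel F] [TopologicalSpace F] [IsNonarchimedeanLocalField F]

/-- `I θ` is a smooth representation (★ `isSmooth_smoothInd`, recorded for the folded spelling `parabolicIndGL`). [cite: BernsteinZelevinsky1977, §2.3] -/
theorem isSmooth_principalSeries (θ : Fin 3 → (Fˣ →* ℂˣ)) :
    (parabolicIndGL F (id : Fin 3 → Fin 3)
      ((Representation.trivial ℂ (Π a : Fin 3, GL {i : Fin 3 // (id : Fin 3 → Fin 3) i = a} F) ℂ).twist
        (∏ a : Fin 3, (θ a).comp (Matrix.GeneralLinearGroup.det.comp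
          (Pi.evalMonoidHom (fun a : Fin 3 => GL {i : Fin 3 // (id : Fin 3 → Fin 3) i = a} F) a))))).IsSmooth :=
  Representation.isSmooth_smoothInd _ _

/-- **`r_B (I θ)` is finite-dimensional** (★ H0-a, recorded for the folded spelling `parabolicIndGL`). [cite: BernsteinZelevinsky1977, §2.12] [cite: Casselman1995, Thm. 6.3.5] -/
theorem finiteDimensional_jacquet_principalSeries (θ : Fin 3 → (Fˣ →* ℂˣ))
    (hθ : IsOpen (((∏ a : Fin 3, (θ a).comp (Matrix.GeneralLinearGroup.det.comp
      (Pi.evalMonoidHom (fun a : Fin 3 => GL {i : Fin 3 // (id : Fin 3 → Fin 3) i = a} F) a)))).ker :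
        Set (Π a : Fin 3, GL {i : Fin 3 // (id : Fin 3 → Fin 3) i = a} F))) :
    FiniteDimensional ℂ (restrictUnipotentGL F (id : Fin 3 → Fin 3) (parabolicIndGL F (id : Fin 3 → Fin 3)
      ((Representation.trivial ℂ (Π a : Fin 3, GL {i : Fin 3 // (id : Fin 3 → Fin 3) i = a} F) ℂ).twist
        (∏ a : Fin 3, (θ a).comp (Matrix.GeneralLinearGroup.det.comp
          (Pi.evalMonoidHom (fun a : Fin 3 => GL {i : Fin 3 // (id : Fin 3 → Fin 3) i = a} F) a)))))).Coinvariants :=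
  (finrank_weightSpace_principalSeries_three_tch θ hθ (fun _ => 0)).1

/-- **EXH (a): every PROPER subrepresentation `N < I θ` leaves a weight in the quotient**: `∃ η, mult (I θ ⁄ N) η ≠ 0` (modulo `h3cell`).
[cite: BernsteinZelevinsky1977, Cor. 2.13, Thm. 2.9] [cite: Casselman1995, §6.3] -/
theorem exists_finrank_weightSpace_quotientRep_principalSeries_ne_zero (θ : Fin 3 → (Fˣ →* ℂˣ))
    (hθ : IsOpen (((∏ a : Fin 3, (θ a).comp (Matrix.GeneralLinearGroup.det.comp
      (Pi.evalMonoidHom (fun a : Fin 3 => GL {i : Fin 3 // (id : Fin 3 → Fin 3) i = a} F) a)))).ker :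
        Set (Π a : Fin 3, GL {i : Fin 3 // (id : Fin 3 → Fin 3) i = a} F)))
    (h3cell : ∀ c : Fin 3 → Fin 2, Monotone c → Function.Surjective c →
      ∀ (W : Type) [AddCommGroup W] [Module ℂ W] (σ : Representation ℂ (Π a : Fin 2, GL {i : Fin 3 // c i = a} F) W),
        σ.IsIrreducible → σ.IsSmooth → σ.IsSupercuspidal →
        ∀ (N : Subrepresentation (jacquetGL F c (parabolicIndGL F (id : Fin 3 → Fin 3)
            ((Representation.trivial ℂ (Π a : Fin 3, GL {i : Fin 3 // (id : Fin 3 → Fin 3) i = a} F) ℂ).twist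
              (∏ a : Fin 3, (θ a).comp (Matrix.GeneralLinearGroup.det.comp
                (Pi.evalMonoidHom (fun a : Fin 3 => GL {i : Fin 3 // (id : Fin 3 → Fin 3) i = a} F) a)))))))
          (q : N.toRepresentation.IntertwiningMap σ), q = 0)
    (N : Subrepresentation (parabolicIndGL F (id : Fin 3 → Fin 3)
      ((Representation.trivial ℂ (Π a : Fin 3, GL {i : Fin 3 // (id : Fin 3 → Fin 3) i = a} F) ℂ).twist
        (∏ a : Fin 3, (θ a).comp (Matrix.GeneralLinearGroup.det.comp
          (Pi.evalMonoidHom (fun a : Fin 3 => GL {i : Fin 3 // (id : Fin 3 → Fin 3) i = a} F) a))))))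
    (hN : N ≠ ⊤) :
    ∃ η : (Π a : Fin 3, GL {i : Fin 3 // (id : Fin 3 → Fin 3) i = a} F) → ℂ,
      finrank ℂ ↥(⨅ m, Module.End.maxGenEigenspace (normalizedJacquetGL F (id : Fin 3 → Fin 3) N.quotientRep m) (η m)) ≠ 0 := by
  haveI := finiteDimensional_jacquet_principalSeries θ hθ
  exact exists_finrank_weightSpace_quotientRep_ne_zero _ (isSmooth_principalSeries θ) (nontrivial_coinvariants_of_isConstituentOf_principalSeries_three_tuple θ h3cell) N hN

/-- **EXH (b): a subrepresentation of `I θ` with ALL the exponents of `I θ` is `I θ`**: `(∀ η, mult N η = mult (I θ) η) → N = ⊤` (modulo `h3cell`).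
[cite: BernsteinZelevinsky1977, Cor. 2.13, Thm. 2.9] [cite: Casselman1995, §6.3] -/
theorem eq_top_of_forall_finrank_weightSpace_eq_principalSeries (θ : Fin 3 → (Fˣ →* ℂˣ))
    (hθ : IsOpen (((∏ a : Fin 3, (θ a).comp (Matrix.GeneralLinearGroup.det.comp
      (Pi.evalMonoidHom (fun a : Fin 3 => GL {i : Fin 3 // (id : Fin 3 → Fin 3) i = a} F) a)))).ker :
        Set (Π a : Fin 3, GL {i : Fin 3 // (id : Fin 3 → Fin 3) i = a} F)))
    (h3cell : ∀ c : Fin 3 → Fin 2, Monotone c → Function.Surjective c →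
      ∀ (W : Type) [AddCommGroup W] [Module ℂ W] (σ : Representation ℂ (Π a : Fin 2, GL {i : Fin 3 // c i = a} F) W),
        σ.IsIrreducible → σ.IsSmooth → σ.IsSupercuspidal →
        ∀ (N : Subrepresentation (jacquetGL F c (parabolicIndGL F (id : Fin 3 → Fin 3)
            ((Representation.trivial ℂ (Π a : Fin 3, GL {i : Fin 3 // (id : Fin 3 → Fin 3) i = a} F) ℂ).twist
              (∏ a : Fin 3, (θ a).comp (Matrix.GeneralLinearGroup.det.comp
                (Pi.evalMonoidHom (fun a : Fin 3 => GL {i : Fin 3 // (id : Fin 3 → Fin 3) i = a} F) a)))))))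
          (q : N.toRepresentation.IntertwiningMap σ), q = 0)
    (N : Subrepresentation (parabolicIndGL F (id : Fin 3 → Fin 3)
      ((Representation.trivial ℂ (Π a : Fin 3, GL {i : Fin 3 // (id : Fin 3 → Fin 3) i = a} F) ℂ).twist
        (∏ a : Fin 3, (θ a).comp (Matrix.GeneralLinearGroup.det.comp
          (Pi.evalMonoidHom (fun a : Fin 3 => GL {i : Fin 3 // (id : Fin 3 → Fin 3) i = a} F) a))))))
    (h : ∀ η : (Π a : Fin 3, GL {i : Fin 3 // (id : Fin 3 → Fin 3) i = a} F) → ℂ,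
      finrank ℂ ↥(⨅ m, Module.End.maxGenEigenspace (normalizedJacquetGL F (id : Fin 3 → Fin 3) N.toRepresentation m) (η m)) =
        finrank ℂ ↥(⨅ m, Module.End.maxGenEigenspace (normalizedJacquetGL F (id : Fin 3 → Fin 3) (parabolicIndGL F (id : Fin 3 → Fin 3)
          ((Representation.trivial ℂ (Π a : Fin 3, GL {i : Fin 3 // (id : Fin 3 → Fin 3) i = a} F) ℂ).twist
            (∏ a : Fin 3, (θ a).comp (Matrix.GeneralLinearGroup.det.comp
              (Pi.evalMonoidHom (fun a : Fin 3 => GL {i : Fin 3 // (id : Fin 3 → Fin 3) i = a} F) a))))) m) (η m))) :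
    N = ⊤ := by
  haveI := finiteDimensional_jacquet_principalSeries θ hθ
  exact eq_top_of_forall_finrank_weightSpace_eq _ (isSmooth_principalSeries θ) (nontrivial_coinvariants_of_isConstituentOf_principalSeries_three_tuple θ h3cell) N h

/-- **EXH (c), nested form: «equal exponents ⇒ equal» for `N₁ ≤ N₂ ≤ I θ`** (modulo `h3cell`). [cite: BernsteinZelevinsky1977, Cor. 2.13, Thm. 2.9] -/
theorem eq_of_le_of_forall_finrank_weightSpace_eq_principalSeries (θ : Fin 3 → (Fˣ →* ℂˣ))
    (hθ : IsOpen (((∏ a : Fin 3, (θ a).comp (Matrix.GeneralLinearGroup.det.comp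
      (Pi.evalMonoidHom (fun a : Fin 3 => GL {i : Fin 3 // (id : Fin 3 → Fin 3) i = a} F) a)))).ker :
        Set (Π a : Fin 3, GL {i : Fin 3 // (id : Fin 3 → Fin 3) i = a} F)))
    (h3cell : ∀ c : Fin 3 → Fin 2, Monotone c → Function.Surjective c →
      ∀ (W : Type) [AddCommGroup W] [Module ℂ W] (σ : Representation ℂ (Π a : Fin 2, GL {i : Fin 3 // c i = a} F) W),
        σ.IsIrreducible → σ.IsSmooth → σ.IsSupercuspidal →
        ∀ (N : Subrepresentation (jacquetGL F c (parabolicIndGL F (id : Fin 3 → Fin 3)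
            ((Representation.trivial ℂ (Π a : Fin 3, GL {i : Fin 3 // (id : Fin 3 → Fin 3) i = a} F) ℂ).twist
              (∏ a : Fin 3, (θ a).comp (Matrix.GeneralLinearGroup.det.comp
                (Pi.evalMonoidHom (fun a : Fin 3 => GL {i : Fin 3 // (id : Fin 3 → Fin 3) i = a} F) a)))))))
          (q : N.toRepresentation.IntertwiningMap σ), q = 0)
    {N₁ N₂ : Subrepresentation (parabolicIndGL F (id : Fin 3 → Fin 3)
      ((Representation.trivial ℂ (Π a : Fin 3, GL {i : Fin 3 // (id : Fin 3 → Fin 3) i = a} F) ℂ).twist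
        (∏ a : Fin 3, (θ a).comp (Matrix.GeneralLinearGroup.det.comp
          (Pi.evalMonoidHom (fun a : Fin 3 => GL {i : Fin 3 // (id : Fin 3 → Fin 3) i = a} F) a)))))}
    (hle : N₁ ≤ N₂)
    (h : ∀ η : (Π a : Fin 3, GL {i : Fin 3 // (id : Fin 3 → Fin 3) i = a} F) → ℂ,
      finrank ℂ ↥(⨅ m, Module.End.maxGenEigenspace (normalizedJacquetGL F (id : Fin 3 → Fin 3) N₁.toRepresentation m) (η m)) =
        finrank ℂ ↥(⨅ m, Module.End.maxGenEigenspace (normalizedJacquetGL F (id : Fin 3 → Fin 3) N₂.toRepresentation m) (η m))) :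
    N₁ = N₂ := by
  haveI := finiteDimensional_jacquet_principalSeries θ hθ
  exact eq_of_le_of_forall_finrank_weightSpace_eq _ (isSmooth_principalSeries θ) (nontrivial_coinvariants_of_isConstituentOf_principalSeries_three_tuple θ h3cell) hle h

/-- **EXH (c), subquotient form: every NON-ZERO SUBQUOTIENT `N₁ ⁄ N₂'` of `I θ` HAS A WEIGHT** (`N₁ ≤ I θ`, `N₂' ≠ ⊤` in `N₁`; modulo `h3cell`).
[cite: BernsteinZelevinsky1977, Cor. 2.13, Thm. 2.9] -/
theorem exists_finrank_weightSpace_subquotient_principalSeries_ne_zero (θ : Fin 3 → (Fˣ →* ℂˣ))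
    (hθ : IsOpen (((∏ a : Fin 3, (θ a).comp (Matrix.GeneralLinearGroup.det.comp
      (Pi.evalMonoidHom (fun a : Fin 3 => GL {i : Fin 3 // (id : Fin 3 → Fin 3) i = a} F) a)))).ker :
        Set (Π a : Fin 3, GL {i : Fin 3 // (id : Fin 3 → Fin 3) i = a} F)))
    (h3cell : ∀ c : Fin 3 → Fin 2, Monotone c → Function.Surjective c →
      ∀ (W : Type) [AddCommGroup W] [Module ℂ W] (σ : Representation ℂ (Π a : Fin 2, GL {i : Fin 3 // c i = a} F) W),
        σ.IsIrreducible → σ.IsSmooth → σ.IsSupercuspidal →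
        ∀ (N : Subrepresentation (jacquetGL F c (parabolicIndGL F (id : Fin 3 → Fin 3)
            ((Representation.trivial ℂ (Π a : Fin 3, GL {i : Fin 3 // (id : Fin 3 → Fin 3) i = a} F) ℂ).twist
              (∏ a : Fin 3, (θ a).comp (Matrix.GeneralLinearGroup.det.comp
                (Pi.evalMonoidHom (fun a : Fin 3 => GL {i : Fin 3 // (id : Fin 3 → Fin 3) i = a} F) a)))))))
          (q : N.toRepresentation.IntertwiningMap σ), q = 0)
    (N₁ : Subrepresentation (parabolicIndGL F (id : Fin 3 → Fin 3)
      ((Representation.trivial ℂ (Π a : Fin 3, GL {i : Fin 3 // (id : Fin 3 → Fin 3) i = a} F) ℂ).twist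
        (∏ a : Fin 3, (θ a).comp (Matrix.GeneralLinearGroup.det.comp
          (Pi.evalMonoidHom (fun a : Fin 3 => GL {i : Fin 3 // (id : Fin 3 → Fin 3) i = a} F) a))))))
    (N₂' : Subrepresentation N₁.toRepresentation) (hN : N₂' ≠ ⊤) :
    ∃ η : (Π a : Fin 3, GL {i : Fin 3 // (id : Fin 3 → Fin 3) i = a} F) → ℂ,
      finrank ℂ ↥(⨅ m, Module.End.maxGenEigenspace (normalizedJacquetGL F (id : Fin 3 → Fin 3) N₂'.quotientRep m) (η m)) ≠ 0 := by
  haveI := finiteDimensional_jacquet_principalSeries θ hθ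
  exact exists_finrank_weightSpace_subquotient_ne_zero _ (isSmooth_principalSeries θ) (nontrivial_coinvariants_of_isConstituentOf_principalSeries_three_tuple θ h3cell) N₁ N₂' hN

end PrincipalSeries

end Summit.HodgeConjecture.HodgeConjecture.Cruxes.H413.K2E3GL3PrincipalSeriesExhaustion

end
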